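import Summits.RiemannHypothesis.RiemannHypothesis.Theorems.SignConeConeMagnificationCombTypePairSum
import Summits.RiemannHypothesis.RiemannHypothesis.Theorems.SignConeConeMagnificationStubCombLocal
import Literature.NumberTheory.LFunctions.WeilCombTwoPointSummable
import Literature.NumberTheory.LFunctions.WeilCombAutocorrelationBump

/-!
# Crux `SignCone.SlackDesign` (stmt-RiemannHypothesis-18009), line `real_comb_type`, stub `stub_pairData` — glue:
# pair-level sharp node data from the SHARP NODE DATA of the parent crux

`stub_pairData` (Cruxes/SlackDesign/Lines/real_comb_type.lean r3) asks, for a Chebyshev–Mertens weight `c ≥ 0`, a level `L ≥ 1` and a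
smooth bump `b ≥ 0` on `[-1,1]`, for the PAIR-LEVEL bound

  `|(E_c − E_Λ)(ℓ,ℓ') − Σ_{n≤3LM} (c−Λ)(n)·((∫b²)√(ℓ/ℓ')·(Σ_{k'≤⌊X_M/(nℓ')⌋}[ℓ ∣ nℓ'k']/k')/n + S(gcd(nℓ',ℓ))/n)| ≤ Cst(log M)^θ`

eventually in `M`, with a class term `|S| ≤ Cst(log M)^θ`, `θ < 1` (`X_M = M/(4√(log M))`, `h = √(log M)/M`).
This file derives it from the parent crux's SHARP NODE DATA in the exact registered shape of seat-0's anchor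
`combTypeSharpNodeData` (stmt-RiemannHypothesis-16303, registered 2026-08-17T11:53Z) — taken here as the hypothesis `hSND` — by the
landed node → pair summation `CombType.pair_difference_of_node_bounds` (p154654): the smooth main terms `hβ√(ℓ'/ℓ)·N(n)` cancel between
`c` and `Λ` up to `8N₀L·hM·(…) = O(√(log M))`, `B(0) = ∫ b²` (`autocorr_zero`), `1/(4h) = X_M` (`comb_params_of_large`), and
`√(log M) ≤ (log M)^{3/4}`.

* `pairData_of_sharpNodeData` — `hSND →` the statement of `stub_pairData` (so `stub_pairData := pairData_of_sharpNodeData combTypeSharpNodeData`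
  the moment the anchor lands).
-/

noncomputable section

-- `Summit.RiemannHypothesis.RiemannHypothesis.…` repeats a namespace component by design (D-0017 layout).
set_option linter.dupNamespace false

open scoped BigOperators Topology ArithmeticFunction.vonMangoldt ContDiff
open MeasureTheory Set Filter

namespace Summit.RiemannHypothesis.RiemannHypothesis.Theorems.SignConeSlackDesign

open Literature.NumberTheory.LFunctions
open Summit.RiemannHypothesis.RiemannHypothesis.Theorems.SignConeConeMagnification

/-- `√x ≤ x^{3/4}` for `x ≥ 1`. [folklore] -/
theorem sqrt_le_rpow_three_quarters {x : ℝ} (hx : 1 ≤ x) : Real.sqrt x ≤ x ^ (3 / 4 : ℝ) := by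
  rw [Real.sqrt_eq_rpow]
  exact Real.rpow_le_rpow_of_exponent_le hx (by norm_num)

/-- **Pair-level sharp node data from the sharp node data.**  See the module docstring; `hSND` is the registered anchor
`combTypeSharpNodeData` of the parent crux verbatim. [folklore] -/
theorem pairData_of_sharpNodeData
    (hSND : ∀ B B' B'' : ℝ → ℝ, ∀ N₀ N₁ N₂ : ℝ, ∀ L : ℕ, (∀ x, HasDerivAt B (B' x) x) → (∀ x, HasDerivAt B' (B'' x) x) →
      (∀ x, |B x| ≤ N₀) → (∀ x, |B' x| ≤ N₁) → (∀ x, |B'' x| ≤ N₂) → (∀ x, 2 < |x| → B x = 0) → (∀ x, 0 ≤ B x) → (1 ≤ L) →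
      ∀ c : ℕ → ℝ, (∀ n, 0 ≤ c n) → ∀ A : ℝ, (∀ N : ℕ, 1 ≤ N → ∑ n ∈ Finset.Icc 1 N, c n ≤ A * N) →
      ∃ E₁ : ℝ, 0 ≤ E₁ ∧ ∃ M₁ : ℕ, ∀ M : ℕ, M₁ ≤ M → 4096 * L ^ 2 ≤ M → ∀ ℓ ∈ Finset.Icc 1 L, ∀ ℓ' ∈ Finset.Icc 1 L,
        ∃ S err : ℕ → ℝ, (∀ δ, |S δ| ≤ E₁ * Real.log M ^ (3 / 4 : ℝ)) ∧
          (∑ n ∈ Finset.Icc 1 (3 * L * M), (c n + ArithmeticFunction.vonMangoldt n) * err n ≤ E₁ * Real.log M ^ (3 / 4 : ℝ)) ∧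
          ∀ n ∈ Finset.Icc 1 (3 * L * M),
            |(∑ k' ∈ Finset.Icc 1 M, (∑ k ∈ Finset.Icc 1 M,
                B ((Real.log ((n : ℝ) * ℓ' * k' / ℓ) - Real.log k) / (Real.sqrt (Real.log M) / M)) / Real.sqrt k) /
                  Real.sqrt k' / Real.sqrt n) -
              B 0 * (Real.sqrt ℓ / Real.sqrt ℓ') *
                (∑ k' ∈ Finset.Icc 1 ⌊1 / (4 * (Real.sqrt (Real.log M) / M)) / ((n : ℝ) * ℓ')⌋₊,
                  (if ℓ ∣ n * ℓ' * k' then 1 / (k' : ℝ) else 0)) / n -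
              (Real.sqrt (Real.log M) / M) * (∫ v, B v * Real.exp (-((Real.sqrt (Real.log M) / M) * v) / 2)) *
                (Real.sqrt ℓ' / Real.sqrt ℓ) *
                ((min M ⌊(ℓ : ℝ) * M * Real.exp (-(2 * (Real.sqrt (Real.log M) / M))) / (ℓ' * n)⌋₊ -
                  ⌊1 / (4 * (Real.sqrt (Real.log M) / M)) / ((n : ℝ) * ℓ')⌋₊ : ℕ) : ℝ) -
              S (Nat.gcd (n * ℓ') ℓ) / n| ≤ err n) :
    ∀ c : ℕ → ℝ, (∀ n, 0 ≤ c n) →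
    (∃ A : ℝ, ∀ x : ℝ, 1 ≤ x → ∑ n ∈ Finset.Icc 1 ⌊x⌋₊, c n ≤ A * x) →
    (∃ C : ℝ, Filter.Tendsto (fun x : ℝ => (∑ n ∈ Finset.Icc 1 ⌊x⌋₊, c n / n) - Real.log x)
      Filter.atTop (nhds C)) →
    ∀ L : ℕ, 1 ≤ L →
    ∀ b : ℝ → ℝ, ContDiff ℝ (⊤ : ℕ∞) b → HasCompactSupport b → tsupport b ⊆ Set.Icc (-1) 1 → (∀ x, 0 ≤ b x) →
    ∃ Cst θ : ℝ, θ < 1 ∧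
      ∀ᶠ M : ℕ in Filter.atTop, ∀ ℓ ∈ Finset.Icc 1 L, ∀ ℓ' ∈ Finset.Icc 1 L,
        ∃ S : ℕ → ℝ,
          (∀ δ, |S δ| ≤ Cst * Real.log M ^ θ) ∧
          (|((∑ n ∈ Finset.Icc 1 (3 * L * M), c n *
                ∑ k' ∈ Finset.Icc 1 M,
                  (∑ k ∈ Finset.Icc 1 M, (∫ u, b u * b (u - (Real.log ((n : ℝ) * ℓ' * k' / ℓ) - Real.log k)
                    / (Real.sqrt (Real.log M) / M))) / Real.sqrt k) / Real.sqrt k' / Real.sqrt n) -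
              ∑ n ∈ Finset.Icc 1 (3 * L * M), (Λ n : ℝ) *
                ∑ k' ∈ Finset.Icc 1 M,
                  (∑ k ∈ Finset.Icc 1 M, (∫ u, b u * b (u - (Real.log ((n : ℝ) * ℓ' * k' / ℓ) - Real.log k)
                    / (Real.sqrt (Real.log M) / M))) / Real.sqrt k) / Real.sqrt k' / Real.sqrt n) -
            ∑ n ∈ Finset.Icc 1 (3 * L * M), (c n - Λ n) *
              ((∫ u, b u ^ 2) * (Real.sqrt ℓ / Real.sqrt ℓ') *
                  (∑ k' ∈ Finset.Icc 1 (⌊(M : ℝ) / (4 * Real.sqrt (Real.log M)) / ((n : ℝ) * ℓ')⌋₊),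
                    (if ℓ ∣ n * ℓ' * k' then (1 : ℝ) / k' else 0)) / n +
                S (Nat.gcd (n * ℓ') ℓ) / n)| ≤ Cst * Real.log M ^ θ) := by
  intro c hc0 hA hMer L hL b hb hbc hbs hb0
  obtain ⟨A, hA⟩ := hA
  -- the autocorrelation package of the bump
  obtain ⟨N₀, N₁, N₂, hB, hB', h0, h1, h2, hBs, hB0⟩ := autocorr_package hb hbc hbs hb0
  set B : ℝ → ℝ := fun v => ∫ u, b u * b (u - v) with hBdef
  have hN₀ : 0 ≤ N₀ := (abs_nonneg _).trans (h0 0)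
  -- Chebyshev along `ℕ` and the bounded Mertens difference
  have hA₁ : ∀ N : ℕ, 1 ≤ N → ∑ n ∈ Finset.Icc 1 N, c n ≤ A * N := chebyshev_nat hA
  obtain ⟨T₀, hT⟩ := exists_abs_dwtSum_le c hMer
  obtain ⟨hT0, hA'0⟩ := diff_consts_nonneg hT (sum_abs_sub_vonMangoldt_le hc0 hA₁)
  -- the sharp node data for this bump and weight
  obtain ⟨E₁, hE₁, M₁, hSN⟩ := hSND B (deriv B) (deriv (deriv B)) N₀ N₁ N₂ L hB hB' h0 h1 h2 hBs hB0 hL c hc0 A hA₁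
  -- constants
  set W : ℝ := 8 * N₀ * L * ((2 * T₀ + 3 * (A + (Real.log 4 + 4))) * L + (T₀ + (A + (Real.log 4 + 4)))) with hW
  have hW0 : 0 ≤ W := by
    have hLR : (0 : ℝ) ≤ L := Nat.cast_nonneg L
    simp only [hW]
    have : 0 ≤ (2 * T₀ + 3 * (A + (Real.log 4 + 4))) * L + (T₀ + (A + (Real.log 4 + 4))) := by positivity
    positivity
  refine ⟨E₁ + W, 3 / 4, by norm_num, ?_⟩
  filter_upwards [eventually_ge_atTop M₁, eventually_ge_atTop (4096 * L ^ 2)] with M hMM₁ hM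
  intro ℓ hℓ ℓ' hℓ'
  obtain ⟨hℓ1, hℓL⟩ := Finset.mem_Icc.1 hℓ
  obtain ⟨hℓ'1, hℓ'L⟩ := Finset.mem_Icc.1 hℓ'
  obtain ⟨hlog1, hκ1, -, hh0, hhL, hhM1, -, -, hX, -, -⟩ := comb_params_of_large hL hM
  set h : ℝ := Real.sqrt (Real.log M) / M with hh
  obtain ⟨S, err, hS, herr, hnode⟩ := hSN M hMM₁ hM ℓ hℓ ℓ' hℓ'
  have hlogθ : 0 ≤ Real.log M ^ (3 / 4 : ℝ) := Real.rpow_nonneg (by linarith) _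
  refine ⟨S, fun δ => (hS δ).trans ?_, ?_⟩
  · nlinarith [hS δ, hlogθ]
  -- the node → pair summation
  have hMpos : 0 < M := by
    have : 1 ≤ 4096 * L ^ 2 := by nlinarith
    omega
  have hN : 1 ≤ 3 * L * M := by nlinarith
  have hpair := CombType.pair_difference_of_node_bounds (B := B) (M := M) (N := 3 * L * M) h0 hBs hB0 hL hℓ1 hℓL hℓ'1 hℓ'L
    hh0 hhL hhM1 hc0 hA₁ hT hN S err hnode
  -- `B 0 = ∫ b²` and `1/(4h) = X_M`
  have hB0int : B 0 = ∫ u, b u ^ 2 := autocorr_zero b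
  have hMR : (0 : ℝ) < M := by exact_mod_cast hMpos
  have hhM : h * M = Real.sqrt (Real.log M) := by simp only [hh]; field_simp
  rw [hB0int] at hpair
  simp only [hX] at hpair
  refine hpair.trans ?_
  -- the error budget: `E₁ (log M)^{3/4} + W √(log M) ≤ (E₁ + W)(log M)^{3/4}`
  have hsq : Real.sqrt (Real.log M) ≤ Real.log M ^ (3 / 4 : ℝ) := sqrt_le_rpow_three_quarters hlog1
  have h2 : 8 * N₀ * L * h * M * ((2 * T₀ + 3 * (A + (Real.log 4 + 4))) * L + (T₀ + (A + (Real.log 4 + 4)))) =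
      W * Real.sqrt (Real.log M) := by
    simp only [hW]
    rw [show 8 * N₀ * L * h * M = 8 * N₀ * L * (h * M) by ring, hhM]
    ring
  rw [h2]
  have h3 : W * Real.sqrt (Real.log M) ≤ W * Real.log M ^ (3 / 4 : ℝ) := mul_le_mul_of_nonneg_left hsq hW0
  nlinarith [herr, h3]

/-- **Anchor `pairDataOfSharpNodeData`** (registered sub-goal of line `real_comb_type`; `pairData_of_sharpNodeData` with the
hypothesis as an implication): sharp node data (parent anchor `combTypeSharpNodeData`, verbatim) ⇒ the pair-level data of
`stub_pairData`. [folklore] -/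
theorem pairDataOfSharpNodeData : (∀ B B' B'' : ℝ → ℝ, ∀ N₀ N₁ N₂ : ℝ, ∀ L : ℕ, (∀ x, HasDerivAt B (B' x) x) → (∀ x, HasDerivAt B' (B'' x) x) → (∀ x, |B x| ≤ N₀) → (∀ x, |B' x| ≤ N₁) → (∀ x, |B'' x| ≤ N₂) → (∀ x, 2 < |x| → B x = 0) → (∀ x, 0 ≤ B x) → (1 ≤ L) → ∀ c : ℕ → ℝ, (∀ n, 0 ≤ c n) → ∀ A : ℝ, (∀ N : ℕ, 1 ≤ N → ∑ n ∈ Finset.Icc 1 N, c n ≤ A * N) → ∃ E₁ : ℝ, 0 ≤ E₁ ∧ ∃ M₁ : ℕ, ∀ M : ℕ, M₁ ≤ M → 4096 * L ^ 2 ≤ M → ∀ ℓ ∈ Finset.Icc 1 L, ∀ ℓ' ∈ Finset.Icc 1 L, ∃ S err : ℕ → ℝ, (∀ δ, |S δ| ≤ E₁ * Real.log M ^ (3 / 4 : ℝ)) ∧ (∑ n ∈ Finset.Icc 1 (3 * L * M), (c n + ArithmeticFunction.vonMangoldt n) * err n ≤ E₁ * Real.log M ^ (3 / 4 : ℝ))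 ∧ ∀ n ∈ Finset.Icc 1 (3 * L * M), |(∑ k' ∈ Finset.Icc 1 M, (∑ k ∈ Finset.Icc 1 M, B ((Real.log ((n : ℝ) * ℓ' * k' / ℓ) - Real.log k) / (Real.sqrt (Real.log M) / M)) / Real.sqrt k) / Real.sqrt k' / Real.sqrt n) - B 0 * (Real.sqrt ℓ / Real.sqrt ℓ') * (∑ k' ∈ Finset.Icc 1 ⌊1 / (4 * (Real.sqrt (Real.log M) / M)) / ((n : ℝ) * ℓ')⌋₊, (if ℓ ∣ n * ℓ' * k' then 1 / (k' : ℝ) else 0)) / n - (Real.sqrt (Real.log M) / M) * (∫ v, B v * Real.exp (-((Real.sqrt (Real.log M) / M) * v) / 2)) * (Real.sqrt ℓ' / Real.sqrt ℓ) * ((min M ⌊(ℓ : ℝ) * M * Real.exp (-(2 * (Real.sqrt (Real.log M) / M))) / (ℓ' * n)⌋₊ - ⌊1 / (4 * (Real.sqrt (Real.log M) / M)) / ((n : ℝ) * ℓ')⌋₊ : ℕ) : ℝ) - S (Nat.gcd (n * ℓ') ℓ) / n| ≤ err n) → ∀ c : ℕ → ℝ, (∀ n, 0 ≤ c n) → (∃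 A : ℝ, ∀ x : ℝ, 1 ≤ x → ∑ n ∈ Finset.Icc 1 ⌊x⌋₊, c n ≤ A * x) → (∃ C : ℝ, Filter.Tendsto (fun x : ℝ => (∑ n ∈ Finset.Icc 1 ⌊x⌋₊, c n / n) - Real.log x) Filter.atTop (nhds C)) → ∀ L : ℕ, 1 ≤ L → ∀ b : ℝ → ℝ, ContDiff ℝ (⊤ : ℕ∞) b → HasCompactSupport b → tsupport b ⊆ Set.Icc (-1) 1 → (∀ x, 0 ≤ b x) → ∃ Cst θ : ℝ, θ < 1 ∧ ∀ᶠ M : ℕ in Filter.atTop, ∀ ℓ ∈ Finset.Icc 1 L, ∀ ℓ' ∈ Finset.Icc 1 L, ∃ S : ℕ → ℝ, (∀ δ, |S δ| ≤ Cst * Real.log M ^ θ) ∧ (|((∑ n ∈ Finset.Icc 1 (3 * L * M), c n * ∑ k' ∈ Finset.Icc 1 M, (∑ k ∈ Finset.Icc 1 M, (∫ u, b u * b (u - (Real.log ((n : ℝ) * ℓ' * k' / ℓ) - Real.log k) / (Real.sqrt (Real.log M) / M))) / Real.sqrt k) / Real.sqrt k' / Real.sqrt n) - ∑ n ∈ Finset.Icc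 1 (3 * L * M), (ArithmeticFunction.vonMangoldt n : ℝ) * ∑ k' ∈ Finset.Icc 1 M, (∑ k ∈ Finset.Icc 1 M, (∫ u, b u * b (u - (Real.log ((n : ℝ) * ℓ' * k' / ℓ) - Real.log k) / (Real.sqrt (Real.log M) / M))) / Real.sqrt k) / Real.sqrt k' / Real.sqrt n) - ∑ n ∈ Finset.Icc 1 (3 * L * M), (c n - ArithmeticFunction.vonMangoldt n) * ((∫ u, b u ^ 2) * (Real.sqrt ℓ / Real.sqrt ℓ') * (∑ k' ∈ Finset.Icc 1 (⌊(M : ℝ) / (4 * Real.sqrt (Real.log M)) / ((n : ℝ) * ℓ')⌋₊), (if ℓ ∣ n * ℓ' * k' then (1 : ℝ) / k' else 0)) / n + S (Nat.gcd (n * ℓ') ℓ) / n)| ≤ Cst * Real.log M ^ θ) :=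
  fun hSND => pairData_of_sharpNodeData hSND

end Summit.RiemannHypothesis.RiemannHypothesis.Theorems.SignConeSlackDesign

end
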